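import Summits.QuantumFields.YangMills.Theorems.BalabanUVNodesN13WilsonPartitionFnAxialTreeUpperBound

/-!
# Route `CoarseStiffnessTail` — PIVOT PEELING: `Z_P(β) ≤ linkMass(β)^{#𝔉}` for EVERY plaquette family with private pivots in some order
# (lead's certificate, seat `ym-line-cst-p1` g15; helper on 25301 `CappedCoarseStiffnessL`, stub S3 = uniform mean action)

THE THEOREM (`partitionFn_le_linkMass_pow_of_peelable`, any regular gauge group `G`, any `Params` `P`, `β ≥ 0`).  Let `𝔉` be a finite
family of plaquettes of the finest torus `T₁^{(0)}`, `piv : Plaq → PBond` and `ρ : Plaq → ℕ` such that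
  (i)   `piv p` is one of the four links of `p` for `p ∈ 𝔉`;
  (ii)  `piv` is injective on `𝔉`;
  (iii) PRIVACY IN ORDER: for `p ≠ q` in `𝔉`, if `piv q` is a link of `p` then `ρ p < ρ q`.
Then `Z_P(β) = ∫ e^{−βA} dU ≤ linkMass(β)^{#𝔉}`, `linkMass β = ∫_G e^{−β(1 − Re tr V)} dV`.

PROOF.  `e^{−βA} ≤ Π_{p∈𝔉} φ_β(U(∂p))` (`boltzmann_le_prod`).  In any sub-family `A ⊆ 𝔉` the member `q` of MINIMAL rank has a private pivot:
no other `p ∈ A` contains `piv q` (by (iii) it would have smaller rank).  Integrating that pivot first (`lmarginal_insert'`): replacing the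
pivot variable by `V` turns `U(∂q)` into `a·V·c` or `a·V⁻¹·c` (`piv q` is the 1st/2nd or the 3rd/4th link) and leaves every other `U(∂p)`,
`p ∈ A ∖ {q}`, unchanged; `∫ φ_β(a·V^{±1}·c) dV = linkMass β` by two-sided Haar invariance and `Re tr W⁻¹ = Re tr W`.  Induction on `#A`
(`lmarginal_prodPlaqFactor_eq_pow_of_peelable`), then the remaining integrations are over probability measures.

This generalises the tree's `BalabanUVNodes.N13WilsonPartitionFnAxialTreeUpperBound` (the axial family in one direction, `(d−1)(1−1/n)|T|`
pivots, peeled by maximal layer) to arbitrary pivot positions and arbitrary peeling orders; the companion file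
`…LCornerCombFamily` exhibits a peelable family with `(d−1)(|T| − 1)` members — the homological maximum — whence
`Z_P(β) ≤ linkMass(β)^{(d−1)(|T|−1)}`: the Gaussian upper bound on `log Z_P` with NO `|T|/n` boundary loss.

WHY (line card `Cruxes/CappedCoarseStiffnessL/Lines/birth.md` §g15).  Stub S3 of the registered skeleton v7 (uniform mean action on
Bałaban's three-tori) is a bound on the partition RATIO `log Z((1−4c₀)β) − log Z(β) ≤ C|T|`; the N13 sandwich leaves `(9/2)(|T|/n) log β`
(g14, `…LTorusPartitionRatio`), which fails exactly in the super-weak corner `log β ≳ n`.  Peeling ALL but `d − 1 + |T|` bonds (this file +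
companion) and gauging a FULL spanning tree (companion `…LCombTreeGauge`) shrink the mismatch to `O(|T| + log β)`.

HONEST SCOPE.  Kernel measure theory (Mathlib `lmarginal`) and finite bookkeeping; nothing of Bałaban's is asserted; the crux 25301, its stubs
S1/S2/S3, `HistoryTailL` 19936 stay OPEN; `YM3TorusSU2` (R3, RECORD rung, not Clay) is NOT proved; the Yang–Mills mass gap is NOT touched.

References: I. Montvay, G. Münster, *Quantum Fields on a Lattice* (1994) §3.2.5 [MontvayMunster1994] (tree gauge / bond elimination);
T. Bałaban, CMP **102** (1985) 255–275 [Balaban1985UV3] ((1)–(3) p.256: the Wilson–Gibbs laws on the tori).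
-/

noncomputable section

open MeasureTheory
open scoped ENNReal BigOperators

namespace Summit.QuantumFields.YangMills.Theorems.CoarseStiffnessTailPivotPeeling

open Literature.MathematicalPhysics.QuantumFieldTheory.Balaban1983to89 Literature.MathematicalPhysics.QuantumFieldTheory.Balaban1983to89.Missing
open Summit.QuantumFields.BalabanUV.T4Continuum.NE7b.BarePartitionFnDecay
  (plaqFactor plaqFactor_pos linkMass linkMassE linkMass_nonneg linkMassE_eq_ofReal linkMassE_ne_top
    measurable_plaqFactor boltzmann_le_prod)
open Summit.QuantumFields.YangMills.BalabanUVNodes.N13WilsonPartitionFnAxialTreeUpperBound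
  (shift_ne_self measurable_prodPlaqFactor lintegral_plaqFactor_mul_mul)

variable {G : Type*} [GaugeGroup G] [MeasurableSpace G] [HaarData G]

/-! ## §1 The four links of a plaquette; updating one of them -/

section Links

variable (P : Params)

omit [MeasurableSpace G] [HaarData G] in
/-- `φ_β(W⁻¹) = φ_β(W)` (`Re tr W⁻¹ = Re tr W`). [folklore] -/
theorem plaqFactor_inv (β : ℝ) (W : G) : plaqFactor β W⁻¹ = plaqFactor β W := by
  unfold plaqFactor; rw [GaugeGroup.reTr_inv]

/-- `∫ φ_β(a·V⁻¹·c) dV = linkMassE β`: invert inside `φ_β` and use two-sided invariance. [folklore] -/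
theorem lintegral_plaqFactor_mul_inv_mul [RegularGaugeGroup G] (β : ℝ) (a c : G) :
    ∫⁻ V, ENNReal.ofReal (plaqFactor β (a * V⁻¹ * c)) ∂(HaarData.haar : Measure G) = linkMassE (G := G) β := by
  have h : ∀ V : G, plaqFactor β (a * V⁻¹ * c) = plaqFactor β (c⁻¹ * V * a⁻¹) := fun V => by
    rw [← plaqFactor_inv β (a * V⁻¹ * c)]
    congr 1
    simp [mul_inv_rev, mul_assoc]
  simp_rw [h]
  exact lintegral_plaqFactor_mul_mul β c⁻¹ a⁻¹

omit [MeasurableSpace G] [HaarData G] in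
/-- The 1st and 3rd links differ (`x + e_ν ≠ x`). [folklore] -/
theorem link1_ne_link3 (p : Plaq P 0) : (⟨p.src, p.μ⟩ : PBond P 0) ≠ ⟨p.src.shift p.ν, p.μ⟩ :=
  fun h => shift_ne_self P p.src p.ν (congrArg PBond.src h).symm

omit [MeasurableSpace G] [HaarData G] in
/-- The 2nd and 4th links differ (`x + e_μ ≠ x`). [folklore] -/
theorem link2_ne_link4 (p : Plaq P 0) : (⟨p.src.shift p.μ, p.ν⟩ : PBond P 0) ≠ ⟨p.src, p.ν⟩ :=
  fun h => shift_ne_self P p.src p.μ (congrArg PBond.src h)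

omit [MeasurableSpace G] [HaarData G] in
/-- Links of different directions differ: 1st vs 2nd. [folklore] -/
theorem link1_ne_link2 (p : Plaq P 0) : (⟨p.src, p.μ⟩ : PBond P 0) ≠ ⟨p.src.shift p.μ, p.ν⟩ :=
  fun h => (Fin.ne_of_lt p.hμν) (congrArg PBond.dir h)

omit [MeasurableSpace G] [HaarData G] in
/-- 1st vs 4th. [folklore] -/
theorem link1_ne_link4 (p : Plaq P 0) : (⟨p.src, p.μ⟩ : PBond P 0) ≠ ⟨p.src, p.ν⟩ :=
  fun h => (Fin.ne_of_lt p.hμν) (congrArg PBond.dir h)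

omit [MeasurableSpace G] [HaarData G] in
/-- 3rd vs 2nd. [folklore] -/
theorem link3_ne_link2 (p : Plaq P 0) : (⟨p.src.shift p.ν, p.μ⟩ : PBond P 0) ≠ ⟨p.src.shift p.μ, p.ν⟩ :=
  fun h => (Fin.ne_of_lt p.hμν) (congrArg PBond.dir h)

omit [MeasurableSpace G] [HaarData G] in
/-- 3rd vs 4th. [folklore] -/
theorem link3_ne_link4 (p : Plaq P 0) : (⟨p.src.shift p.ν, p.μ⟩ : PBond P 0) ≠ ⟨p.src, p.ν⟩ :=
  fun h => (Fin.ne_of_lt p.hμν) (congrArg PBond.dir h)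

variable [DecidableEq (PBond P 0)]

omit [MeasurableSpace G] [HaarData G] in
/-- Updating a bond which is NOT a link of `p` does not change `U(∂p)`. [folklore] -/
theorem plaqHol_update_of_not_link (U : GaugeField P 0 G) (V : G) (p : Plaq P 0) (b : PBond P 0)
    (h1 : b ≠ ⟨p.src, p.μ⟩) (h2 : b ≠ ⟨p.src.shift p.μ, p.ν⟩) (h3 : b ≠ ⟨p.src.shift p.ν, p.μ⟩) (h4 : b ≠ ⟨p.src, p.ν⟩) :
    GaugeField.plaqHol (Function.update U b V) p = GaugeField.plaqHol U p := by
  unfold GaugeField.plaqHol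
  rw [Function.update_of_ne h1.symm, Function.update_of_ne h2.symm, Function.update_of_ne h3.symm, Function.update_of_ne h4.symm]

/-- **THE PIVOT INTEGRAL**: if `b` is one of the four links of `p`, `∫ φ_β(U[b ↦ V](∂p)) dV = linkMassE β` whatever the other
three links (`U(∂p) = a·V·c` for the 1st/2nd link, `a·V⁻¹·c` for the 3rd/4th). [folklore] -/
theorem lintegral_plaqFactor_update_link [RegularGaugeGroup G] (β : ℝ) (U : GaugeField P 0 G) (p : Plaq P 0) (b : PBond P 0)
    (hb : b = ⟨p.src, p.μ⟩ ∨ b = ⟨p.src.shift p.μ, p.ν⟩ ∨ b = ⟨p.src.shift p.ν, p.μ⟩ ∨ b = ⟨p.src, p.ν⟩) :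
    ∫⁻ V, ENNReal.ofReal (plaqFactor β (GaugeField.plaqHol (Function.update U b V) p)) ∂(HaarData.haar : Measure G) =
      linkMassE (G := G) β := by
  rcases hb with rfl | rfl | rfl | rfl
  · -- first link: `V · U₂ · U₃⁻¹ · U₄⁻¹ = 1 · V · (U₂ U₃⁻¹ U₄⁻¹)`
    have h : ∀ V : G, GaugeField.plaqHol (Function.update U ⟨p.src, p.μ⟩ V) p =
        1 * V * (U ⟨p.src.shift p.μ, p.ν⟩ * (U ⟨p.src.shift p.ν, p.μ⟩)⁻¹ * (U ⟨p.src, p.ν⟩)⁻¹) := fun V => by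
      unfold GaugeField.plaqHol
      rw [Function.update_self, Function.update_of_ne (link1_ne_link2 P p).symm,
        Function.update_of_ne (link1_ne_link3 P p).symm, Function.update_of_ne (link1_ne_link4 P p).symm]
      simp [mul_assoc]
    simp_rw [h]; exact lintegral_plaqFactor_mul_mul β _ _
  · -- second link
    have h : ∀ V : G, GaugeField.plaqHol (Function.update U ⟨p.src.shift p.μ, p.ν⟩ V) p =
        U ⟨p.src, p.μ⟩ * V * ((U ⟨p.src.shift p.ν, p.μ⟩)⁻¹ * (U ⟨p.src, p.ν⟩)⁻¹) := fun V => by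
      unfold GaugeField.plaqHol
      rw [Function.update_self, Function.update_of_ne (link1_ne_link2 P p),
        Function.update_of_ne (link3_ne_link2 P p), Function.update_of_ne (link2_ne_link4 P p).symm]
      simp [mul_assoc]
    simp_rw [h]; exact lintegral_plaqFactor_mul_mul β _ _
  · -- third link: `U₁ U₂ · V⁻¹ · U₄⁻¹`
    have h : ∀ V : G, GaugeField.plaqHol (Function.update U ⟨p.src.shift p.ν, p.μ⟩ V) p =
        (U ⟨p.src, p.μ⟩ * U ⟨p.src.shift p.μ, p.ν⟩) * V⁻¹ * (U ⟨p.src, p.ν⟩)⁻¹ := fun V => by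
      unfold GaugeField.plaqHol
      rw [Function.update_self, Function.update_of_ne (link1_ne_link3 P p),
        Function.update_of_ne (link3_ne_link2 P p).symm, Function.update_of_ne (link3_ne_link4 P p).symm]
    simp_rw [h]; exact lintegral_plaqFactor_mul_inv_mul β _ _
  · -- fourth link: `U₁ U₂ U₃⁻¹ · V⁻¹ · 1`
    have h : ∀ V : G, GaugeField.plaqHol (Function.update U ⟨p.src, p.ν⟩ V) p =
        (U ⟨p.src, p.μ⟩ * U ⟨p.src.shift p.μ, p.ν⟩ * (U ⟨p.src.shift p.ν, p.μ⟩)⁻¹) * V⁻¹ * 1 := fun V => by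
      unfold GaugeField.plaqHol
      rw [Function.update_self, Function.update_of_ne (link1_ne_link4 P p),
        Function.update_of_ne (link2_ne_link4 P p), Function.update_of_ne (link3_ne_link4 P p), mul_one]
    simp_rw [h]; exact lintegral_plaqFactor_mul_inv_mul β _ _

end Links

/-! ## §2 Peeling: the marginal over the pivots of a peelable family is `linkMassE β ^ #A` -/

section Peel

variable (P : Params) [RegularGaugeGroup G] [DecidableEq (PBond P 0)]

/-- **★★ THE MARGINAL OVER THE PIVOTS OF A PEELABLE FAMILY.**  Let `𝔉` be a plaquette family with pivots `piv` (each a link of its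
plaquette, injective on `𝔉`) and a rank `ρ` such that `piv q` is a link of another member `p` only if `ρ p < ρ q`.  Then for every
`A ⊆ 𝔉`: `∫⋯∫⁻_{piv(A)} Π_{p∈A} φ_β(U(∂p)) = linkMassE β ^ #A` identically in the remaining variables (peel the member of minimal rank:
its pivot is private; induction on `#A`). [folklore] -/
theorem lmarginal_prodPlaqFactor_eq_pow_of_peelable (β : ℝ) (𝔉 : Finset (Plaq P 0)) (piv : Plaq P 0 → PBond P 0)
    (ρ : Plaq P 0 → ℕ)
    (hlink : ∀ p ∈ 𝔉, piv p = ⟨p.src, p.μ⟩ ∨ piv p = ⟨p.src.shift p.μ, p.ν⟩ ∨ piv p = ⟨p.src.shift p.ν, p.μ⟩ ∨ piv p = ⟨p.src, p.ν⟩)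
    (hinj : Set.InjOn piv (𝔉 : Set (Plaq P 0)))
    (hpriv : ∀ p ∈ 𝔉, ∀ q ∈ 𝔉, p ≠ q →
      (piv q = ⟨p.src, p.μ⟩ ∨ piv q = ⟨p.src.shift p.μ, p.ν⟩ ∨ piv q = ⟨p.src.shift p.ν, p.μ⟩ ∨ piv q = ⟨p.src, p.ν⟩) → ρ p < ρ q) :
    ∀ (n : ℕ) (A : Finset (Plaq P 0)), A.card = n → A ⊆ 𝔉 →
      (∫⋯∫⁻_(A.image piv), (fun U : GaugeField P 0 G => ∏ p ∈ A, ENNReal.ofReal (plaqFactor β (GaugeField.plaqHol U p)))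
          ∂(fun _ : PBond P 0 => (HaarData.haar : Measure G))) = fun _ => linkMassE (G := G) β ^ n := by
  classical
  haveI : IsProbabilityMeasure (HaarData.haar (G := G)) := HaarData.isProb
  intro n
  induction n with
  | zero =>
    intro A hA _
    rw [Finset.card_eq_zero] at hA
    subst hA
    ext U
    simp
  | succ n ih =>
    intro A hA hA𝔉
    have hne : A.Nonempty := by rw [← Finset.card_pos, hA]; exact Nat.succ_pos n
    obtain ⟨q, hqA, hqmin⟩ := Finset.exists_min_image A ρ hne
    have hq𝔉 : q ∈ 𝔉 := hA𝔉 hqA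
    set A' : Finset (Plaq P 0) := A.erase q with hA'def
    have hqA' : q ∉ A' := Finset.notMem_erase q A
    have hAeq : A = insert q A' := (Finset.insert_erase hqA).symm
    have hA'card : A'.card = n := by rw [hA'def, Finset.card_erase_of_mem hqA, hA]; omega
    have hA'𝔉 : A' ⊆ 𝔉 := fun p hp => hA𝔉 (Finset.mem_of_mem_erase hp)
    -- the pivot of `q` is not a pivot of `A'`
    have hnot : piv q ∉ A'.image piv := by
      rw [Finset.mem_image]
      rintro ⟨p, hp, hpe⟩
      have hpq : p = q := hinj (hA'𝔉 hp) hq𝔉 hpe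
      exact hqA' (hpq ▸ hp)
    -- the pivot of `q` is a link of no other member of `A`
    have hprivate : ∀ p ∈ A', piv q ≠ ⟨p.src, p.μ⟩ ∧ piv q ≠ ⟨p.src.shift p.μ, p.ν⟩ ∧ piv q ≠ ⟨p.src.shift p.ν, p.μ⟩ ∧
        piv q ≠ ⟨p.src, p.ν⟩ := by
      intro p hp
      have hpA : p ∈ A := Finset.mem_of_mem_erase hp
      have hne : p ≠ q := Finset.ne_of_mem_erase hp
      have hle : ρ q ≤ ρ p := hqmin p hpA
      by_contra hcon
      have hor : piv q = ⟨p.src, p.μ⟩ ∨ piv q = ⟨p.src.shift p.μ, p.ν⟩ ∨ piv q = ⟨p.src.shift p.ν, p.μ⟩ ∨ piv q = ⟨p.src, p.ν⟩ := by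
        tauto
      have hlt := hpriv p (hA'𝔉 hp) q hq𝔉 hne hor
      omega
    rw [hAeq, Finset.image_insert, lmarginal_insert' _ (measurable_prodPlaqFactor P β _) hnot]
    -- the inner (pivot) integral
    have hinner : (fun U : PBond P 0 → G => ∫⁻ V, (∏ p ∈ insert q A', ENNReal.ofReal (plaqFactor β
        (GaugeField.plaqHol (Function.update U (piv q) V) p))) ∂(HaarData.haar : Measure G)) =
        fun U => linkMassE (G := G) β * ∏ p ∈ A', ENNReal.ofReal (plaqFactor β (GaugeField.plaqHol U p)) := by
      ext U
      have hrew : ∀ V : G, (∏ p ∈ insert q A', ENNReal.ofReal (plaqFactor β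
          (GaugeField.plaqHol (Function.update U (piv q) V) p))) =
          ENNReal.ofReal (plaqFactor β (GaugeField.plaqHol (Function.update U (piv q) V) q)) *
            ∏ p ∈ A', ENNReal.ofReal (plaqFactor β (GaugeField.plaqHol U p)) := by
        intro V
        rw [Finset.prod_insert hqA']
        congr 1
        refine Finset.prod_congr rfl fun p hp => ?_
        obtain ⟨h1, h2, h3, h4⟩ := hprivate p hp
        rw [plaqHol_update_of_not_link P U V p (piv q) h1 h2 h3 h4]
      simp_rw [hrew]
      have hmeas : Measurable fun V : G =>
          ENNReal.ofReal (plaqFactor β (GaugeField.plaqHol (Function.update U (piv q) V) q)) := by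
        refine ((measurable_plaqFactor β).comp ?_).ennreal_ofReal
        exact (measurable_plaqHol q).comp (measurable_update U)
      rw [lintegral_mul_const _ hmeas, lintegral_plaqFactor_update_link P β U q (piv q) (hlink q hq𝔉), mul_comm]
    rw [hinner]
    ext U
    have hih := congrFun (ih A' hA'card hA'𝔉) U
    simp only [lmarginal] at hih ⊢
    rw [lintegral_const_mul' _ _ (linkMassE_ne_top β), hih, pow_succ, mul_comm]

/-- `∫ Π_{p∈𝔉} φ_β(U(∂p)) dU ≤ linkMassE β ^ #𝔉` for a peelable family: the marginal over the pivots is that constant, the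
remaining integrations are over probability measures. [folklore] -/
theorem lintegral_prodPlaqFactor_le_of_peelable (β : ℝ) (𝔉 : Finset (Plaq P 0)) (piv : Plaq P 0 → PBond P 0)
    (ρ : Plaq P 0 → ℕ)
    (hlink : ∀ p ∈ 𝔉, piv p = ⟨p.src, p.μ⟩ ∨ piv p = ⟨p.src.shift p.μ, p.ν⟩ ∨ piv p = ⟨p.src.shift p.ν, p.μ⟩ ∨ piv p = ⟨p.src, p.ν⟩)
    (hinj : Set.InjOn piv (𝔉 : Set (Plaq P 0)))
    (hpriv : ∀ p ∈ 𝔉, ∀ q ∈ 𝔉, p ≠ q →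
      (piv q = ⟨p.src, p.μ⟩ ∨ piv q = ⟨p.src.shift p.μ, p.ν⟩ ∨ piv q = ⟨p.src.shift p.ν, p.μ⟩ ∨ piv q = ⟨p.src, p.ν⟩) → ρ p < ρ q) :
    ∫⁻ U, (∏ p ∈ 𝔉, ENNReal.ofReal (plaqFactor β (GaugeField.plaqHol U p))) ∂fieldMeasure P 0 G ≤
      linkMassE (G := G) β ^ 𝔉.card := by
  haveI : IsProbabilityMeasure (HaarData.haar (G := G)) := HaarData.isProb
  have hconst : (∫⋯∫⁻_(𝔉.image piv), (fun _ : GaugeField P 0 G => linkMassE (G := G) β ^ 𝔉.card)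
      ∂(fun _ : PBond P 0 => (HaarData.haar : Measure G))) = fun _ => linkMassE (G := G) β ^ 𝔉.card := by
    ext U
    simp only [lmarginal, lintegral_const, measure_univ, mul_one]
  have hfg := ((lmarginal_prodPlaqFactor_eq_pow_of_peelable P β 𝔉 piv ρ hlink hinj hpriv 𝔉.card 𝔉 rfl
    subset_rfl).trans hconst.symm).le
  have h := lintegral_le_of_lmarginal_le (μ := fun _ : PBond P 0 => (HaarData.haar : Measure G))
    (𝔉.image piv) (measurable_prodPlaqFactor P β 𝔉) measurable_const hfg
  have hpi : fieldMeasure P 0 G = Measure.pi fun _ : PBond P 0 => (HaarData.haar : Measure G) := rfl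
  rw [hpi]
  refine h.trans (le_of_eq ?_)
  rw [lintegral_const, measure_univ, mul_one]

/-- **★★★ `Z_P(β) ≤ linkMass(β) ^ #𝔉` FOR EVERY PEELABLE FAMILY** (`β ≥ 0`, any regular gauge group, any `Params`): drop the other
plaquettes (`boltzmann_le_prod`) and peel (§2). [folklore] -/
theorem partitionFn_le_linkMass_pow_of_peelable {β : ℝ} (hβ : 0 ≤ β) (𝔉 : Finset (Plaq P 0)) (piv : Plaq P 0 → PBond P 0)
    (ρ : Plaq P 0 → ℕ)
    (hlink : ∀ p ∈ 𝔉, piv p = ⟨p.src, p.μ⟩ ∨ piv p = ⟨p.src.shift p.μ, p.ν⟩ ∨ piv p = ⟨p.src.shift p.ν, p.μ⟩ ∨ piv p = ⟨p.src, p.ν⟩)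
    (hinj : Set.InjOn piv (𝔉 : Set (Plaq P 0)))
    (hpriv : ∀ p ∈ 𝔉, ∀ q ∈ 𝔉, p ≠ q →
      (piv q = ⟨p.src, p.μ⟩ ∨ piv q = ⟨p.src.shift p.μ, p.ν⟩ ∨ piv q = ⟨p.src.shift p.ν, p.μ⟩ ∨ piv q = ⟨p.src, p.ν⟩) → ρ p < ρ q) :
    partitionFn (G := G) P β ≤ linkMass (G := G) β ^ 𝔉.card := by
  classical
  have hint := integrable_boltzmann (G := G) RegularGaugeGroup.measurable_reTr P hβ
  have h1 : ENNReal.ofReal (partitionFn (G := G) P β) = ∫⁻ U, ENNReal.ofReal (boltzmann P β U) ∂fieldMeasure P 0 G :=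
    ofReal_integral_eq_lintegral_ofReal hint (Filter.Eventually.of_forall fun U => (boltzmann_pos P β U).le)
  have h2 : ∫⁻ U, ENNReal.ofReal (boltzmann P β U) ∂fieldMeasure P 0 G ≤ linkMassE (G := G) β ^ 𝔉.card := by
    refine le_trans (lintegral_mono fun U => ?_) (lintegral_prodPlaqFactor_le_of_peelable P β 𝔉 piv ρ hlink hinj hpriv)
    calc ENNReal.ofReal (boltzmann P β U)
        ≤ ENNReal.ofReal (∏ p ∈ 𝔉, plaqFactor β (GaugeField.plaqHol U p)) := ENNReal.ofReal_le_ofReal (boltzmann_le_prod P hβ 𝔉 U)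
      _ = ∏ p ∈ 𝔉, ENNReal.ofReal (plaqFactor β (GaugeField.plaqHol U p)) :=
          ENNReal.ofReal_prod_of_nonneg fun p _ => (plaqFactor_pos β _).le
  have h3 : ENNReal.ofReal (partitionFn (G := G) P β) ≤ ENNReal.ofReal (linkMass (G := G) β ^ 𝔉.card) := by
    rw [h1, ENNReal.ofReal_pow (linkMass_nonneg β), ← linkMassE_eq_ofReal]
    exact h2
  exact (ENNReal.ofReal_le_ofReal_iff (pow_nonneg (linkMass_nonneg β) _)).mp h3

end Peel

end Summit.QuantumFields.YangMills.Theorems.CoarseStiffnessTailPivotPeeling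

end
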